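import Mathlib
import HarnessLib
import Literature.NumberTheory.LFunctions.ZetaScrew
import Literature.NumberTheory.LFunctions.UniformWeilPositivityRH
import Summits.RiemannHypothesis.RiemannHypothesis.Theorems.IntegerScrewWeilWindowConverse

/-!
# Route `IntegerScrew` — the SCREW ↔ WEIL dictionary in RATIO form, and where RH sits in the integer
# screw matrices: the top windows `(M/R, M]` of large matrices, ratio by ratio (PIVOT-LAW §16; RH-FREE glue,
# EXCEPT the labelled RH-EQUIVALENT `∀`-ratio statements of §7–§8, which are Weil's criterion re-indexed)

Sequel to `IntegerScrewWeilWindowConverse` (the exact dictionary at depth `a`: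
`WeilPositivityOn a ↔` non-negativity of `S_M = [G(log m, log m')]` on the balanced vectors of all —
equivalently all sufficiently high — integer windows `(N, M]` of log-length `< 2a`).  Here:

* `screwForm_balanced_nonneg_of_diam_le` — CLOSED diameter: `WeilPositivityOn a` gives the zero-sum
  inequality for real configurations of diameter `≤ 2a` (scale by `c ↑ 1`, continuity of `Ψ`);
* `weilPositivityOn_log_half_iff_forall_ratio_window` (and `…_iff_eventually_ratio_window`) — for
  `R : ℕ`: **`WeilPositivityOn ((log R)/2) ↔ ∀ N M, M ≤ R(N+1) → ∀ x, ∑_{N<m≤M} x_m = 0 →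
  0 ≤ ∑_{N<m,m'≤M} G(log m, log m') x_m x_{m'}`** (resp. only for `N ≥ N₀`): each fixed ratio `R` of
  Suzuki's integer screw matrices is EXACTLY the Weil rung `(log R)/2` (RH-free for `R ≤ 7`, gen21);
* `riemannHypothesis_iff_forall_ratio_eventually_screwWindow` — **RH ⟺ for every ratio `R` there is
  `N₀` with `S_M ⪰ 0` on every balanced vector supported on `(N, M]` for all `N ≥ N₀`, `M ≤ R(N+1)`**
  (Weil's criterion `riemannHypothesis_iff_forall_weilPositivityOn` through the ratio dictionary): the
  IntegerScrew criterion is decided on the TOP windows of LARGE matrices, ratio by ratio; the RH-hardness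
  lives entirely in `R → ∞`.  `riemannHypothesis_iff_forall_balanced_screwWindow`: all-windows form.
* §8 EVENTUAL DICHOTOMY (RH-FREE): `eventually_exists_negative_window_of_not_weilPositivityOn` — if
  Weil positivity FAILS at depth `a`, then for ALL sufficiently large `N` some window `(N, M]` of
  log-length `< 2a` (ratio `≤ ⌈e^{2a}⌉`, `eventually_exists_negative_ratio_window_of_not_weilPositivityOn`)
  carries a balanced vector with negative form (the node realisation `exists_nodes_tendsto_screwForm`
  converges along the whole sequence `N → ∞`): at each depth, either every window is non-negative or
  every high level fails.  Hence `not_riemannHypothesis_iff_exists_ratio_eventually_negative_window`: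
  **¬RH ⟺ some ratio `R` fails on every sufficiently high window** — PIVOT-LAW §16.2's ARGUED paragraph
  («under ¬RH balanced vectors of bounded ratio with negative form exist for all large `M`») as a theorem.

LABEL: RH-FREE glue; the `∀ R` statements are RH-EQUIVALENT (labelled, Weil's criterion), never claimed.
WHAT THIS IS NOT: not progress toward RH; nothing here bears on the truth of RH.

References: M. Suzuki, J. Lond. Math. Soc. (2) 108 (2023) 1448–1487 = arXiv:2206.03682, (1.4)–(1.5),
Thm 1.2, Prop. 3.1 [Suzuki2023]; A. Weil (1952); H. Yoshida, Adv. Stud. Pure Math. 21 (1992);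
E. Bombieri, Rend. Lincei (9) 11 (2000) Thm. 2.
-/

noncomputable section

-- D-0017: `Summit.<S>.<S>.…` is the designed namespace of a single-problem summit.
set_option linter.dupNamespace false

namespace Summit.RiemannHypothesis.RiemannHypothesis.Theorems.IntegerScrew

open Literature.NumberTheory.LFunctions Finset Filter Topology
open Summit.RiemannHypothesis.RiemannHypothesis.Theorems.KernelOfWeilOn
  (sum_sum_mul_zetaScrew_nonpos_of_psd)
open Summit.RiemannHypothesis.RiemannHypothesis.Theorems.ZetaStringArchWall
  (isPosSemidefKernelOn_zetaScrewKernel_iff_weilPositivityOn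
    weilPositivityOn_iff_sum_sum_zetaScrewKernel_nonneg)

/-! ## §6 Closed diameter `2a` and the RATIO form `M ≤ R(N+1)` -/

/-- Closed diameter: `WeilPositivityOn a` gives `0 ≤ ∑ᵢⱼ G(sᵢ, sⱼ) yᵢ yⱼ` for zero-sum systems of
diameter `≤ 2a` (not only `< 2a`): scale the configuration by `c ↑ 1` and use continuity of `Ψ`.
[cite: Suzuki2023, (1.4)–(1.5) and Prop 3.1] -/
theorem screwForm_balanced_nonneg_of_diam_le {a : ℝ} (hW : WeilPositivityOn a) {n : ℕ}
    (s y : Fin n → ℝ) (hs : ∀ i j, s i - s j ≤ 2 * a) (hy : ∑ i, y i = 0) :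
    0 ≤ ∑ i, ∑ j, zetaScrewKernel (s i) (s j) * (y i * y j) := by
  by_cases ha : 0 < a
  swap
  · -- `a ≤ 0`: all points coincide, `Ψ(0) = 0`, and the one-point terms cancel
    have heq : ∀ i j, s i - s j = 0 := fun i j => by
      linarith [hs i j, hs j i, not_lt.1 ha]
    rw [sum_sum_zetaScrewKernel_eq_neg_of_sum_eq_zero s y hy]
    simp only [heq, zetaScrew_zero, mul_zero, Finset.sum_const_zero, neg_zero, le_refl]
  -- `a > 0`: the open-window statement from the dictionary
  have hopen : ∀ t : Fin n → ℝ, (∀ i j, t i - t j < 2 * a) →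
      0 ≤ ∑ i, ∑ j, zetaScrewKernel (t i) (t j) * (y i * y j) := by
    intro t ht
    have hpsd := (isPosSemidefKernelOn_zetaScrewKernel_iff_weilPositivityOn a).2 hW
    have h := sum_sum_mul_zetaScrew_nonpos_of_psd hpsd t y ht hy
    rw [sum_sum_zetaScrewKernel_eq_neg_of_sum_eq_zero t y hy]
    linarith
  -- scale by `c < 1`, `c → 1`
  have hform : Tendsto (fun c : ℝ => ∑ i, ∑ j, zetaScrewKernel (c * s i) (c * s j) * (y i * y j))
      (𝓝[<] (1 : ℝ)) (𝓝 (∑ i, ∑ j, zetaScrewKernel (s i) (s j) * (y i * y j))) := by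
    have hc : ∀ k, Tendsto (fun c : ℝ => c * s k) (𝓝[<] (1 : ℝ)) (𝓝 (s k)) := by
      intro k
      have h1 : Tendsto (fun c : ℝ => c * s k) (𝓝 (1 : ℝ)) (𝓝 (1 * s k)) :=
        tendsto_id.mul tendsto_const_nhds
      rw [one_mul] at h1
      exact h1.mono_left nhdsWithin_le_nhds
    exact tendsto_screwForm (u := fun c k => c * s k) hc y
  have hev : ∀ᶠ c : ℝ in 𝓝[<] (1 : ℝ),
      0 ≤ ∑ i, ∑ j, zetaScrewKernel (c * s i) (c * s j) * (y i * y j) := by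
    have h1 : ∀ᶠ c : ℝ in 𝓝[<] (1 : ℝ), c < 1 := self_mem_nhdsWithin
    have h0 : ∀ᶠ c : ℝ in 𝓝[<] (1 : ℝ), 0 < c :=
      (lt_mem_nhds (zero_lt_one' ℝ)).filter_mono nhdsWithin_le_nhds
    filter_upwards [h0.and h1] with c hc
    refine hopen (fun k => c * s k) fun i j => ?_
    have h1 : c * s i - c * s j = c * (s i - s j) := by ring
    rw [h1]
    rcases le_or_gt (s i - s j) 0 with hneg | hpos
    · have : c * (s i - s j) ≤ 0 := mul_nonpos_of_nonneg_of_nonpos hc.1.le hneg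
      linarith
    · calc c * (s i - s j) < 1 * (s i - s j) := mul_lt_mul_of_pos_right hc.2 hpos
        _ ≤ 2 * a := by rw [one_mul]; exact hs i j
  exact ge_of_tendsto hform hev

/-- **RATIO FORM, WEIL ⟹ SCREW** (RH-FREE glue): for `R : ℕ`, `WeilPositivityOn ((log R)/2)` implies
the balanced-window inequality on every window `(N, M]` with `M ≤ R(N+1)` (ratio `≤ R`, closed).
For `R = 7` with the tree's rung `a = 1 ≥ (log 7)/2` this is gen21's
`screwWindow_nonneg_of_le_seven_mul`. [cite: Suzuki2023, (1.4)–(1.5) and Prop 3.1] -/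
theorem screwWindow_nonneg_of_weilPositivityOn_ratio {R : ℕ} (hW : WeilPositivityOn (Real.log R / 2))
    (N M : ℕ) (hNM : M ≤ R * (N + 1)) (x : ℕ → ℝ) (hx : ∑ m ∈ Ioc N M, x m = 0) :
    0 ≤ ∑ m ∈ Ioc N M, ∑ m' ∈ Ioc N M,
      zetaScrewKernel (Real.log m) (Real.log m') * (x m * x m') := by
  refine screwWindow_nonneg_of_nodes (fun n nd hnd y hy => ?_) x hx
  refine screwForm_balanced_nonneg_of_diam_le hW _ y (fun i j => ?_) hy
  have hN1 : (0 : ℝ) < (N : ℝ) + 1 := by positivity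
  have hi2 : (nd i : ℝ) ≤ M := by exact_mod_cast (hnd i).2
  have hj1 : (N : ℝ) + 1 ≤ nd j := by exact_mod_cast Nat.succ_le_of_lt (hnd j).1
  have hipos : (0 : ℝ) < nd i := hN1.trans_le (by exact_mod_cast Nat.succ_le_of_lt (hnd i).1)
  have hMpos : (0 : ℝ) < M := hipos.trans_le hi2
  have hMR : (M : ℝ) ≤ R * ((N : ℝ) + 1) := by exact_mod_cast hNM
  have hRpos : (0 : ℝ) < R := by
    rcases Nat.eq_zero_or_pos R with h0 | h0
    · exfalso; rw [h0, zero_mul] at hNM; have h1 := (hnd i).1; have h2 := (hnd i).2; omega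
    · exact_mod_cast h0
  have hli : Real.log (nd i) ≤ Real.log M := Real.log_le_log hipos hi2
  have hlj : Real.log ((N : ℝ) + 1) ≤ Real.log (nd j) := Real.log_le_log hN1 hj1
  have hlM : Real.log M ≤ Real.log R + Real.log ((N : ℝ) + 1) := by
    rw [← Real.log_mul hRpos.ne' hN1.ne']
    exact Real.log_le_log hMpos hMR
  linarith

/-- **RATIO FORM, SCREW TAIL ⟹ WEIL** (RH-FREE): if for some `N₀` the balanced-window inequality holds
on all windows `(N, M]` with `N ≥ N₀` and `M ≤ R(N+1)`, then `WeilPositivityOn ((log R)/2)`.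
[cite: Suzuki2023, (1.4)–(1.5) and Prop 3.1] -/
theorem weilPositivityOn_log_half_of_eventually_ratio_window {R : ℕ}
    (h : ∃ N₀ : ℕ, ∀ N M : ℕ, N₀ ≤ N → M ≤ R * (N + 1) →
      ∀ x : ℕ → ℝ, ∑ m ∈ Ioc N M, x m = 0 →
        0 ≤ ∑ m ∈ Ioc N M, ∑ m' ∈ Ioc N M,
          zetaScrewKernel (Real.log m) (Real.log m') * (x m * x m')) :
    WeilPositivityOn (Real.log R / 2) := by
  obtain ⟨N₀, hN₀⟩ := h
  refine weilPositivityOn_of_eventually_screwWindow_nonneg ⟨N₀, fun N M hN hNM x hx => ?_⟩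
  -- empty windows are trivial; a non-empty window of log-length `< log R` has ratio `< R`
  rcases le_or_gt M N with hMN | hMN
  · simp [Finset.Ioc_eq_empty_of_le hMN]
  refine hN₀ N M hN ?_ x hx
  have hN1 : (0 : ℝ) < (N : ℝ) + 1 := by positivity
  have hM1 : (N : ℝ) + 1 ≤ M := by exact_mod_cast Nat.succ_le_of_lt hMN
  have hMpos : (0 : ℝ) < M := hN1.trans_le hM1
  have h2 : Real.log M < Real.log R + Real.log ((N : ℝ) + 1) := by linarith
  have hR1 : (1 : ℝ) < R := by
    by_contra hc
    have hlogR : Real.log R ≤ 0 := Real.log_nonpos (Nat.cast_nonneg R) (not_lt.1 hc)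
    have hlogM : Real.log ((N : ℝ) + 1) ≤ Real.log M := Real.log_le_log hN1 hM1
    linarith
  have hRpos : (0 : ℝ) < R := zero_lt_one.trans hR1
  rw [← Real.log_mul hRpos.ne' hN1.ne'] at h2
  have h3 : (M : ℝ) < R * ((N : ℝ) + 1) := (Real.log_lt_log_iff hMpos (by positivity)).1 h2
  exact (show M < R * (N + 1) by exact_mod_cast h3).le

/-- **RATIO DICTIONARY.** For every `R : ℕ`: `WeilPositivityOn ((log R)/2) ↔` the balanced-window
inequality on every window `(N, M]` with `M ≤ R(N+1)`.  Each fixed ratio `R` of the IntegerScrew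
matrices is EXACTLY the Weil rung `(log R)/2` — RH-free today for `R ≤ 7` (the tree's `a = 1`), an
RH-consequence certified depth by depth beyond, and for ALL `R` it is RH
(`riemannHypothesis_iff_forall_ratio_eventually_screwWindow`). [cite: Suzuki2023, (1.4)–(1.5), Thm 1.2 and Prop 3.1] -/
theorem weilPositivityOn_log_half_iff_forall_ratio_window (R : ℕ) :
    WeilPositivityOn (Real.log R / 2) ↔ ∀ N M : ℕ, M ≤ R * (N + 1) →
      ∀ x : ℕ → ℝ, ∑ m ∈ Ioc N M, x m = 0 →
        0 ≤ ∑ m ∈ Ioc N M, ∑ m' ∈ Ioc N M,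
          zetaScrewKernel (Real.log m) (Real.log m') * (x m * x m') :=
  ⟨fun hW N M hNM x hx => screwWindow_nonneg_of_weilPositivityOn_ratio hW N M hNM x hx,
    fun h => weilPositivityOn_log_half_of_eventually_ratio_window ⟨0, fun N M _ hNM => h N M hNM⟩⟩

/-- **RATIO DICTIONARY (tail form).** `WeilPositivityOn ((log R)/2) ↔ ∃ N₀, ∀ N ≥ N₀, ∀ M ≤ R(N+1)`,
the balanced-window inequality on `(N, M]`. [cite: Suzuki2023, (1.4)–(1.5), Thm 1.2 and Prop 3.1] -/
theorem weilPositivityOn_log_half_iff_eventually_ratio_window (R : ℕ) :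
    WeilPositivityOn (Real.log R / 2) ↔ ∃ N₀ : ℕ, ∀ N M : ℕ, N₀ ≤ N → M ≤ R * (N + 1) →
      ∀ x : ℕ → ℝ, ∑ m ∈ Ioc N M, x m = 0 →
        0 ≤ ∑ m ∈ Ioc N M, ∑ m' ∈ Ioc N M,
          zetaScrewKernel (Real.log m) (Real.log m') * (x m * x m') :=
  ⟨fun hW => ⟨0, fun N M _ hNM x hx => screwWindow_nonneg_of_weilPositivityOn_ratio hW N M hNM x hx⟩,
    weilPositivityOn_log_half_of_eventually_ratio_window⟩

/-! ## §7 Where RH sits in the integer screw matrices -/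

/-- **RH ⟺ balanced windows of every ratio, in the tail** (RH-EQUIVALENT, labelled; Weil's criterion
`riemannHypothesis_iff_forall_weilPositivityOn` through the ratio dictionary): RH holds iff for every
ratio `R` there is `N₀` such that `S_M` is non-negative on every balanced vector supported on `(N, M]`,
for all `N ≥ N₀` and `M ≤ R(N+1)`.  The IntegerScrew criterion is decided on the top windows
`(M/R, M]` of large matrices, ratio by ratio; the RH-hardness lives entirely in `R → ∞`.
[cite: Suzuki2023, Thm 1.2; Bombieri2000Weil, Thm. 2] -/
theorem riemannHypothesis_iff_forall_ratio_eventually_screwWindow :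
    _root_.RiemannHypothesis ↔ ∀ R : ℕ, ∃ N₀ : ℕ, ∀ N M : ℕ, N₀ ≤ N → M ≤ R * (N + 1) →
      ∀ x : ℕ → ℝ, ∑ m ∈ Ioc N M, x m = 0 →
        0 ≤ ∑ m ∈ Ioc N M, ∑ m' ∈ Ioc N M,
          zetaScrewKernel (Real.log m) (Real.log m') * (x m * x m') := by
  rw [riemannHypothesis_iff_forall_weilPositivityOn]
  constructor
  · intro h R
    rw [← weilPositivityOn_log_half_iff_eventually_ratio_window]
    by_cases hR : 0 < Real.log R / 2
    · exact h _ hR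
    · exact weilPositivityOn_of_le_log_two_half
        ((not_lt.1 hR).trans (div_nonneg (Real.log_nonneg one_le_two) zero_le_two))
  · intro h a ha
    -- depth `a` is below the rung `(log R)/2` of the ratio `R = ⌈e^{2a}⌉`
    set R : ℕ := ⌈Real.exp (2 * a)⌉₊ with hR
    have hW := (weilPositivityOn_log_half_iff_eventually_ratio_window R).2 (h R)
    refine WeilPositivityOn.mono ?_ hW
    have h1 : Real.exp (2 * a) ≤ R := Nat.le_ceil _
    have h2 : 2 * a ≤ Real.log R := by
      rw [Real.le_log_iff_exp_le ((Real.exp_pos _).trans_le h1)]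
      exact h1
    linarith

/-- **RH ⟺ all balanced windows** (RH-EQUIVALENT, labelled): RH holds iff `S_M` is non-negative on
every balanced vector supported on `(N, M]`, for all `N < M` — the balanced-hyperplane form of
`IntegerScrewPSD`, with the ratio made explicit by the previous theorem. [cite: Suzuki2023, Thm 1.2] -/
theorem riemannHypothesis_iff_forall_balanced_screwWindow :
    _root_.RiemannHypothesis ↔ ∀ (N M : ℕ) (x : ℕ → ℝ), ∑ m ∈ Ioc N M, x m = 0 →
      0 ≤ ∑ m ∈ Ioc N M, ∑ m' ∈ Ioc N M,
        zetaScrewKernel (Real.log m) (Real.log m') * (x m * x m') := by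
  constructor
  · intro h N M x hx
    have h' := riemannHypothesis_iff_forall_ratio_eventually_screwWindow.1 h
    -- the window `(N, M]` has ratio `≤ M + 1`
    have hW : WeilPositivityOn (Real.log ((M + 1 : ℕ) : ℝ) / 2) := by
      rw [weilPositivityOn_log_half_iff_eventually_ratio_window]
      exact h' (M + 1)
    exact screwWindow_nonneg_of_weilPositivityOn_ratio hW N M
      ((Nat.le_succ M).trans (Nat.le_mul_of_pos_right _ (Nat.succ_pos N))) x hx
  · intro h
    exact riemannHypothesis_iff_forall_ratio_eventually_screwWindow.2
      fun R => ⟨0, fun N M _ _ x hx => h N M x hx⟩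

/-! ## §8 EVENTUAL DICHOTOMY: a failing depth fails on EVERY sufficiently high window -/

/-- NODE REALISATION WITH ITS LIMIT (the construction behind the density transfer of
`IntegerScrewWeilWindowConverse`, with the limit exposed): for `0 < a`, a real configuration `s` with
differences `< 2a` and zero-sum weights `y`, there are node families `nd N : Fin n → ℕ` and tops `Mx N`
with `N < nd N k ≤ Mx N`, eventually `log (Mx N) − log(N+1) < 2a`, and
`∑ᵢⱼ G(log nd N i, log nd N j) yᵢ yⱼ → ∑ᵢⱼ G(sᵢ, sⱼ) yᵢ yⱼ` (`nd N k = ⌈(N+1)e^{s_k − min s}⌉`,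
`Mx N = ⌈(N+1)e^{max s − min s}⌉`). [folklore] -/
theorem exists_nodes_tendsto_screwForm {a : ℝ} (ha : 0 < a) {n : ℕ} (s y : Fin n → ℝ)
    (hs : ∀ i j, s i - s j < 2 * a) (hy : ∑ i, y i = 0) :
    ∃ (nd : ℕ → Fin n → ℕ) (Mx : ℕ → ℕ), (∀ N k, N < nd N k ∧ nd N k ≤ Mx N) ∧
      (∀ᶠ N : ℕ in atTop, Real.log (Mx N) - Real.log ((N : ℝ) + 1) < 2 * a) ∧
      Tendsto (fun N => ∑ i, ∑ j,
        zetaScrewKernel (Real.log (nd N i)) (Real.log (nd N j)) * (y i * y j)) atTop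
        (𝓝 (∑ i, ∑ j, zetaScrewKernel (s i) (s j) * (y i * y j))) := by
  rcases Nat.eq_zero_or_pos n with hn | hn
  · subst hn
    refine ⟨fun N _ => N + 1, fun N => N + 1, fun N _ => ⟨N.lt_succ_self, le_rfl⟩,
      Eventually.of_forall fun N => ?_, by simp⟩
    push_cast
    linarith
  haveI : Nonempty (Fin n) := Fin.pos_iff_nonempty.1 hn
  have hne : (Finset.univ : Finset (Fin n)).Nonempty := Finset.univ_nonempty
  obtain ⟨imin, -, himin⟩ := Finset.exists_min_image Finset.univ s hne
  obtain ⟨imax, -, himax⟩ := Finset.exists_max_image Finset.univ s hne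
  set smin : ℝ := s imin with hsmin_def
  set D : ℝ := s imax - smin with hD_def
  have hsmin : ∀ k, smin ≤ s k := fun k => himin k (Finset.mem_univ k)
  have hD : ∀ k, s k - smin ≤ D := fun k => by
    have := himax k (Finset.mem_univ k); rw [hD_def]; linarith
  have hD2a : D < 2 * a := hs imax imin
  refine ⟨fun N k => ⌈((N : ℝ) + 1) * Real.exp (s k - smin)⌉₊,
    fun N => ⌈((N : ℝ) + 1) * Real.exp D⌉₊,
    fun N k => ⟨lt_ceil_node (sub_nonneg.2 (hsmin k)), ceil_node_mono N (hD k)⟩,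
    (tendsto_log_ceil_sub_log D).eventually (eventually_lt_nhds hD2a), ?_⟩
  -- recentred by `−log(N+1)` the nodes converge to `s − smin`; balanced forms ignore the recentring
  have hu : ∀ k, Tendsto (fun N : ℕ =>
      Real.log (⌈((N : ℝ) + 1) * Real.exp (s k - smin)⌉₊ : ℕ) - Real.log ((N : ℝ) + 1))
      atTop (𝓝 (s k - smin)) := fun k => tendsto_log_ceil_sub_log (s k - smin)
  have hform := tendsto_screwForm (s := fun k => s k - smin) hu y
  have e1 : ∀ N : ℕ, ∑ i, ∑ j, zetaScrewKernel
      (Real.log (⌈((N : ℝ) + 1) * Real.exp (s i - smin)⌉₊ : ℕ) - Real.log ((N : ℝ) + 1))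
      (Real.log (⌈((N : ℝ) + 1) * Real.exp (s j - smin)⌉₊ : ℕ) - Real.log ((N : ℝ) + 1))
        * (y i * y j) =
      ∑ i, ∑ j, zetaScrewKernel (Real.log (⌈((N : ℝ) + 1) * Real.exp (s i - smin)⌉₊ : ℕ))
        (Real.log (⌈((N : ℝ) + 1) * Real.exp (s j - smin)⌉₊ : ℕ)) * (y i * y j) := by
    intro N
    have e : ∀ k, Real.log (⌈((N : ℝ) + 1) * Real.exp (s k - smin)⌉₊ : ℕ) - Real.log ((N : ℝ) + 1)
        = Real.log (⌈((N : ℝ) + 1) * Real.exp (s k - smin)⌉₊ : ℕ) + (-Real.log ((N : ℝ) + 1)) :=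
      fun k => sub_eq_add_neg _ _
    simp only [e]
    exact screwForm_add_const_of_sum_eq_zero _ y _ hy
  have e2 : ∑ i, ∑ j, zetaScrewKernel (s i - smin) (s j - smin) * (y i * y j) =
      ∑ i, ∑ j, zetaScrewKernel (s i) (s j) * (y i * y j) := by
    have e : ∀ k, s k - smin = s k + (-smin) := fun k => sub_eq_add_neg _ _
    simp only [e]
    exact screwForm_add_const_of_sum_eq_zero s y _ hy
  simp only [e1, e2] at hform
  exact hform

/-- **EVENTUAL DICHOTOMY** (RH-FREE): if Weil positivity FAILS at depth `a`, then EVERY sufficiently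
high window carries a failure — there is `N₁` such that for all `N ≥ N₁` some window `(N, M]` of
log-length `< 2a` supports a balanced real vector with `∑ G(log m, log m') x_m x_{m'} < 0`.  With
`weilPositivityOn_iff_eventually_screwWindow_nonneg`: at each depth either ALL windows are non-negative
or ALL sufficiently high levels fail — no intermittency in `N`. [folklore] -/
theorem eventually_exists_negative_window_of_not_weilPositivityOn {a : ℝ}
    (h : ¬ WeilPositivityOn a) :
    ∃ N₁ : ℕ, ∀ N : ℕ, N₁ ≤ N → ∃ M : ℕ, Real.log M - Real.log ((N : ℝ) + 1) < 2 * a ∧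
      ∃ x : ℕ → ℝ, ∑ m ∈ Ioc N M, x m = 0 ∧
        ∑ m ∈ Ioc N M, ∑ m' ∈ Ioc N M,
          zetaScrewKernel (Real.log m) (Real.log m') * (x m * x m') < 0 := by
  have ha : 0 < a := by
    by_contra ha
    exact h (weilPositivityOn_of_le_log_two_half
      ((not_lt.1 ha).trans (div_nonneg (Real.log_nonneg one_le_two) zero_le_two)))
  rw [weilPositivityOn_iff_sum_sum_zetaScrewKernel_nonneg] at h
  push Not at h
  obtain ⟨n, t, c, ht, hneg⟩ := h
  -- augment by the node `0` with the balancing weight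
  have hy : ∑ i, (Fin.cons (-∑ i, c i) c : Fin (n + 1) → ℝ) i = 0 := by
    rw [Fin.sum_univ_succ]
    simp only [Fin.cons_zero, Fin.cons_succ]
    ring
  have hs : ∀ i j, (Fin.cons 0 t : Fin (n + 1) → ℝ) i - (Fin.cons 0 t : Fin (n + 1) → ℝ) j
      < 2 * a := by
    have hpt : ∀ i, |(Fin.cons 0 t : Fin (n + 1) → ℝ) i| < a := by
      intro i
      refine Fin.cases ?_ (fun k => ?_) i
      · simp [ha]
      · simpa using ht k
    intro i j
    have hi := abs_lt.1 (hpt i)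
    have hj := abs_lt.1 (hpt j)
    linarith [hi.2, hj.1]
  have hneg' : ∑ i, ∑ j, zetaScrewKernel ((Fin.cons 0 t : Fin (n + 1) → ℝ) i)
      ((Fin.cons 0 t : Fin (n + 1) → ℝ) j) * ((Fin.cons (-∑ i, c i) c : Fin (n + 1) → ℝ) i *
        (Fin.cons (-∑ i, c i) c : Fin (n + 1) → ℝ) j) < 0 := by
    rw [sum_sum_zetaScrewKernel_eq_neg_of_sum_eq_zero _ _ hy]
    rw [Suzuki2023Thm42.sum_sum_zetaScrewKernel_eq_neg t c] at hneg
    exact hneg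
  obtain ⟨nd, Mx, hnd, hwin, hlim⟩ := exists_nodes_tendsto_screwForm ha _ _ hs hy
  have hev := (hlim.eventually (eventually_lt_nhds hneg')).and hwin
  obtain ⟨N₁, hN₁⟩ := eventually_atTop.1 hev
  refine ⟨N₁, fun N hN => ?_⟩
  obtain ⟨hlt, hw⟩ := hN₁ N hN
  refine ⟨Mx N, hw, ?_⟩
  by_contra hcon
  push Not at hcon
  exact absurd (screwForm_nodes_nonneg_of_window hcon (nd N) (hnd N) _ hy) (not_le.2 hlt)

/-- Ratio form of the dichotomy: a failing depth `a` gives a ratio `R = ⌈e^{2a}⌉` that fails on every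
sufficiently high window `(N, M]`, `M ≤ R(N+1)`. [folklore] -/
theorem eventually_exists_negative_ratio_window_of_not_weilPositivityOn {a : ℝ}
    (h : ¬ WeilPositivityOn a) :
    ∃ N₁ : ℕ, ∀ N : ℕ, N₁ ≤ N → ∃ M : ℕ, M ≤ ⌈Real.exp (2 * a)⌉₊ * (N + 1) ∧
      ∃ x : ℕ → ℝ, ∑ m ∈ Ioc N M, x m = 0 ∧
        ∑ m ∈ Ioc N M, ∑ m' ∈ Ioc N M,
          zetaScrewKernel (Real.log m) (Real.log m') * (x m * x m') < 0 := by
  obtain ⟨N₁, hN₁⟩ := eventually_exists_negative_window_of_not_weilPositivityOn h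
  refine ⟨N₁, fun N hN => ?_⟩
  obtain ⟨M, hM, x, hx, hneg⟩ := hN₁ N hN
  refine ⟨M, ?_, x, hx, hneg⟩
  rcases Nat.eq_zero_or_pos M with hM0 | hM0
  · rw [hM0]; exact Nat.zero_le _
  have hN1 : (0 : ℝ) < (N : ℝ) + 1 := by positivity
  have hMpos : (0 : ℝ) < M := by exact_mod_cast hM0
  have h1 : Real.log M < Real.log (Real.exp (2 * a) * ((N : ℝ) + 1)) := by
    rw [Real.log_mul (Real.exp_pos _).ne' hN1.ne', Real.log_exp]
    linarith
  have h2 : (M : ℝ) < Real.exp (2 * a) * ((N : ℝ) + 1) :=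
    (Real.log_lt_log_iff hMpos (by positivity)).1 h1
  have h3 : Real.exp (2 * a) * ((N : ℝ) + 1) ≤ (⌈Real.exp (2 * a)⌉₊ : ℕ) * ((N : ℝ) + 1) :=
    mul_le_mul_of_nonneg_right (Nat.le_ceil _) hN1.le
  have h4 : (M : ℝ) < ((⌈Real.exp (2 * a)⌉₊ * (N + 1) : ℕ) : ℝ) := by
    push_cast
    exact h2.trans_le h3
  exact (Nat.cast_lt.1 h4).le

/-- **¬RH in the integer screw matrices** (RH-EQUIVALENT content, labelled; PIVOT-LAW §16.2's ARGUED
paragraph as a theorem): RH fails iff SOME ratio `R` fails on EVERY sufficiently high window — there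
are `R, N₁` such that for all `N ≥ N₁` some `(N, M]` with `M ≤ R(N+1)` supports a balanced vector with
negative screw form (so every large `S_M'`, `M' ≥ R(N₁+1)`, has a negative balanced vector on a window
of ratio `≤ R` near its top).  Under RH no window ever fails. [cite: Suzuki2023, Thm 1.2; Bombieri2000Weil, Thm. 2] -/
theorem not_riemannHypothesis_iff_exists_ratio_eventually_negative_window :
    ¬ _root_.RiemannHypothesis ↔ ∃ R N₁ : ℕ, ∀ N : ℕ, N₁ ≤ N → ∃ M : ℕ, M ≤ R * (N + 1) ∧
      ∃ x : ℕ → ℝ, ∑ m ∈ Ioc N M, x m = 0 ∧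
        ∑ m ∈ Ioc N M, ∑ m' ∈ Ioc N M,
          zetaScrewKernel (Real.log m) (Real.log m') * (x m * x m') < 0 := by
  constructor
  · intro h
    rw [riemannHypothesis_iff_forall_weilPositivityOn] at h
    push Not at h
    obtain ⟨a, -, hW⟩ := h
    exact ⟨⌈Real.exp (2 * a)⌉₊, eventually_exists_negative_ratio_window_of_not_weilPositivityOn hW⟩
  · rintro ⟨R, N₁, h⟩ hRH
    obtain ⟨M, -, x, hx, hneg⟩ := h N₁ le_rfl
    have := (riemannHypothesis_iff_forall_balanced_screwWindow.1 hRH) N₁ M x hx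
    linarith

end Summit.RiemannHypothesis.RiemannHypothesis.Theorems.IntegerScrew

end
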